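import Summits.CriticalPhenomena.PercolationContinuityZ3.Theorems.PercNearOneGluingNoHeavyLowerTailCornerAsymptotics
import Summits.CriticalPhenomena.PercolationContinuityZ3.Theorems.PercNearOneGluingNoHeavyLowerTailCornerCuts
import HarnessLib

/-!
# `NoHeavyLowerTail` (stmt-CriticalPhenomena-4575) — corner programme, layer 3a:
# realizer families, the up-families `F_a`, the two-cover lemma and the NO-THREE-ANTICHAIN theorem

Bookkeeping for the corner event-gluing theorem (`…CornerEventGluing`, memo A5-COUPLING-gen2 §4.6): order-`m`
realizers of an event as open sets `S ⊆ E`, their corner weights `Λ`, the exit event `X = {o ↔ A} ∩ {o ↮ b}`,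
the up-families `F_a = {S : order-m realizer of {a ↮ b}, o ∈ C_a(S)}` with `R_m(X) = ⋃_a F_a`
(`mem_realizers_exit_iff`), the finite covering lemma (`exists_two_cover`: no three pairwise ⊆-incomparable sets
⇒ two of them contain all), the no-three-antichain theorem for up-families (`upFam_no_three_antichain`, from
`…CornerCuts.card_bdry_inter_add_union_le` and `…CutAntichain.cut_inter₃_eq_zero`), and the identification of
the four tripod-exchange events' realizers with sub-families (`mem_realizers_tripod_of_mem_sdiff`,
`realizers_tripod_subset_sdiff`, `order_tripod_left/right`).  Pure combinatorics plus the definition of `leading`;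
[folklore] bookkeeping, nothing about the crux is asserted.
-/

noncomputable section

namespace Summit.CriticalPhenomena.PercolationContinuityZ3.Theorems

open MeasureTheory Filter Topology Finset
open Literature.Probability.LatticeModels Literature.Probability.Percolation

namespace Corner

open scoped Classical

variable {V : Type*} [Fintype V] [DecidableEq V]

/-! ### Realizer families and their weights -/

/-- The order-`m` realizers of the event `D` on the support `E`: open sets `S ⊆ E` in `D` with exactly `m` closed
support pairs. [folklore] -/
def realizers (E : Finset (Sym2 V)) (D : Set (Set (Sym2 V))) (m : ℕ) : Finset (Finset (Sym2 V)) :=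
  E.powerset.filter fun S => (↑S : Set (Sym2 V)) ∈ D ∧ (E \ S).card = m

/-- The corner weight of a family of open sets: `Λ(𝓕) = Σ_{S ∈ 𝓕} ∏_{e ∈ E \ S} λ_e`. [folklore] -/
def famWeight (E : Finset (Sym2 V)) (lam : Sym2 V → ℝ) (𝓕 : Finset (Finset (Sym2 V))) : ℝ :=
  ∑ S ∈ 𝓕, ∏ e ∈ E \ S, lam e

omit [Fintype V] in
/-- Membership in the realizer family. [folklore] -/
theorem mem_realizers {E : Finset (Sym2 V)} {D : Set (Set (Sym2 V))} {m : ℕ} {S : Finset (Sym2 V)} :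
    S ∈ realizers E D m ↔ S ⊆ E ∧ (↑S : Set (Sym2 V)) ∈ D ∧ (E \ S).card = m := by
  rw [realizers, Finset.mem_filter, Finset.mem_powerset]

omit [Fintype V] in
/-- The leading coefficient is the weight of the realizer family. [folklore] -/
theorem leading_eq_famWeight (E : Finset (Sym2 V)) (lam : Sym2 V → ℝ) (D : Set (Set (Sym2 V))) (m : ℕ) :
    leading E lam D m = famWeight E lam (realizers E D m) := by
  -- `leading` was stated with the classical `DecidableEq`; `congr!` identifies the instances
  unfold leading famWeight realizers
  rw [Finset.sum_filter]
  congr!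

omit [Fintype V] in
/-- Family weights are monotone under inclusion (`λ ≥ 0` on `E`). [folklore] -/
theorem famWeight_mono {E : Finset (Sym2 V)} {lam : Sym2 V → ℝ} (hlam : ∀ e ∈ E, 0 ≤ lam e)
    {𝓕 𝓖 : Finset (Finset (Sym2 V))} (h : 𝓕 ⊆ 𝓖) : famWeight E lam 𝓕 ≤ famWeight E lam 𝓖 :=
  Finset.sum_le_sum_of_subset_of_nonneg h fun _ _ _ =>
    Finset.prod_nonneg fun e he => hlam e (Finset.mem_sdiff.1 he).1

omit [Fintype V] in
/-- Family weights are nonnegative (`λ ≥ 0` on `E`). [folklore] -/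
theorem famWeight_nonneg {E : Finset (Sym2 V)} {lam : Sym2 V → ℝ} (hlam : ∀ e ∈ E, 0 ≤ lam e)
    (𝓕 : Finset (Finset (Sym2 V))) : 0 ≤ famWeight E lam 𝓕 :=
  Finset.sum_nonneg fun _ _ => Finset.prod_nonneg fun e he => hlam e (Finset.mem_sdiff.1 he).1

omit [Fintype V] in
/-- Weight of a union with a relative complement: `Λ(𝓕 ∪ 𝓖) = Λ(𝓕) + Λ(𝓖 \ 𝓕)`. [folklore] -/
theorem famWeight_union_eq {E : Finset (Sym2 V)} {lam : Sym2 V → ℝ} (𝓕 𝓖 : Finset (Finset (Sym2 V))) :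
    famWeight E lam (𝓕 ∪ 𝓖) = famWeight E lam 𝓕 + famWeight E lam (𝓖 \ 𝓕) := by
  rw [famWeight, famWeight, famWeight, ← Finset.sum_union Finset.disjoint_sdiff, Finset.union_sdiff_self_eq_union]

omit [Fintype V] in
/-- Weight of a superset: `Λ(𝓖) = Λ(𝓕) + Λ(𝓖 \ 𝓕)` for `𝓕 ⊆ 𝓖`. [folklore] -/
theorem famWeight_eq_add_sdiff {E : Finset (Sym2 V)} {lam : Sym2 V → ℝ} {𝓕 𝓖 : Finset (Finset (Sym2 V))}
    (h : 𝓕 ⊆ 𝓖) : famWeight E lam 𝓖 = famWeight E lam 𝓕 + famWeight E lam (𝓖 \ 𝓕) := by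
  rw [famWeight, famWeight, famWeight, ← Finset.sum_sdiff h, add_comm]

/-! ### The up-families `F_a` and the exit event -/

/-- The exit event `X = {o ↔ A} ∩ {o ↮ b}`. [folklore] -/
def exitEvent (A : Finset V) (o b : V) : Set (BondConfig V) := (⋃ a ∈ A, openConn o a) ∩ (openConn o b)ᶜ

/-- The up-family of the relay `a`: order-`m` realizers of `{a ↮ b}` whose `a`-cluster contains `o`. [folklore] -/
def upFam (E : Finset (Sym2 V)) (m : ℕ) (o b a : V) : Finset (Finset (Sym2 V)) :=
  (realizers E (openConn a b)ᶜ m).filter fun S => o ∈ clus (↑S : Set (Sym2 V)) a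

/-- Membership in the up-family. [folklore] -/
theorem mem_upFam {E : Finset (Sym2 V)} {m : ℕ} {o b a : V} {S : Finset (Sym2 V)} :
    S ∈ upFam E m o b a ↔ S ⊆ E ∧ ¬ (openGraph (↑S : Set (Sym2 V))).Reachable a b ∧ (E \ S).card = m ∧
      (openGraph (↑S : Set (Sym2 V))).Reachable a o := by
  simp only [upFam, Finset.mem_filter, mem_realizers, mem_clus, Set.mem_compl_iff, openConn, Set.mem_setOf_eq,
    and_assoc]

/-- The up-family lies in the realizer family of `{a ↮ b}`. [folklore] -/
theorem upFam_subset (E : Finset (Sym2 V)) (m : ℕ) (o b a : V) :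
    upFam E m o b a ⊆ realizers E (openConn a b)ᶜ m := Finset.filter_subset _ _

/-- **The order-`m` realizers of the exit event are the union of the up-families.** [folklore] -/
theorem mem_realizers_exit_iff {E : Finset (Sym2 V)} {m : ℕ} {A : Finset V} {o b : V} {S : Finset (Sym2 V)} :
    S ∈ realizers E (exitEvent A o b) m ↔ ∃ a ∈ A, S ∈ upFam E m o b a := by
  constructor
  · intro h
    rw [mem_realizers] at h
    obtain ⟨hSE, hX, hcard⟩ := h
    simp only [exitEvent, Set.mem_inter_iff, Set.mem_iUnion, Set.mem_compl_iff, openConn, Set.mem_setOf_eq] at hX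
    obtain ⟨⟨a, ha, hoa⟩, hob⟩ := hX
    refine ⟨a, ha, mem_upFam.2 ⟨hSE, fun hab => hob (hoa.trans hab), hcard, hoa.symm⟩⟩
  · rintro ⟨a, ha, h⟩
    obtain ⟨hSE, hab, hcard, hao⟩ := mem_upFam.1 h
    refine mem_realizers.2 ⟨hSE, ?_, hcard⟩
    simp only [exitEvent, Set.mem_inter_iff, Set.mem_iUnion, Set.mem_compl_iff, openConn, Set.mem_setOf_eq]
    exact ⟨⟨a, ha, hao.symm⟩, fun hob => hab (hao.trans hob)⟩

/-- Inside an up-family, membership in another up-family is read off the `o`-cluster: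
for `S ∈ F_a`, `S ∈ F_t ↔ t ∈ C_o(S)`. [folklore] -/
theorem mem_upFam_iff_mem_clus {E : Finset (Sym2 V)} {m : ℕ} {o b a t : V} {S : Finset (Sym2 V)}
    (hS : S ∈ upFam E m o b a) : S ∈ upFam E m o b t ↔ t ∈ clus (↑S : Set (Sym2 V)) o := by
  obtain ⟨hSE, hab, hcard, hao⟩ := mem_upFam.1 hS
  rw [mem_clus, mem_upFam]
  constructor
  · rintro ⟨-, -, -, hto⟩; exact hto.symm
  · intro hot
    exact ⟨hSE, fun htb => hab (hao.trans (hot.trans htb)), hcard, hot.symm⟩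

/-- For `S ∈ F_a`: the `o`-cluster contains `a`, does not contain `b`, and has exactly `m` boundary pairs when
`{a ↮ b}` has order `≥ m`. [folklore] -/
theorem clus_facts_of_mem_upFam {E : Finset (Sym2 V)} {m : ℕ} {o b a : V} {S : Finset (Sym2 V)}
    (hS : S ∈ upFam E m o b a)
    (hma : ∀ T ∈ E.powerset, (↑T : Set (Sym2 V)) ∈ (openConn a b)ᶜ → m ≤ (E \ T).card) :
    a ∈ clus (↑S : Set (Sym2 V)) o ∧ b ∉ clus (↑S : Set (Sym2 V)) o ∧
      (bdry E (clus (↑S : Set (Sym2 V)) o)).card = m := by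
  obtain ⟨hSE, hab, hcard, hao⟩ := mem_upFam.1 hS
  have ha : a ∈ clus (↑S : Set (Sym2 V)) o := mem_clus.2 hao.symm
  have hb : b ∉ clus (↑S : Set (Sym2 V)) o := fun h => hab (hao.trans (mem_clus.1 h))
  refine ⟨ha, hb, le_antisymm ?_ (le_card_bdry_of_order hma ha hb)⟩
  calc (bdry E (clus (↑S : Set (Sym2 V)) o)).card ≤ (E \ S).card := card_bdry_clus_le_card_sdiff o
    _ = m := hcard

/-! ### A finite covering lemma: no three-antichain ⇒ two maximal classes cover -/

omit [Fintype V] [DecidableEq V] in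
/-- If among the sets `F a` (`a ∈ A`, `A` nonempty) no three are pairwise `⊆`-incomparable, then two of them
contain all the others. [folklore] -/
theorem exists_two_cover {α β : Type*} [DecidableEq β] (A : Finset α) (F : α → Finset β) (hA : A.Nonempty)
    (h3 : ∀ t₁ ∈ A, ∀ t₂ ∈ A, ∀ t₃ ∈ A, ¬ F t₁ ⊆ F t₂ → ¬ F t₂ ⊆ F t₁ → ¬ F t₁ ⊆ F t₃ → ¬ F t₃ ⊆ F t₁ →
      ¬ F t₂ ⊆ F t₃ → ¬ F t₃ ⊆ F t₂ → False) :
    ∃ t₁ ∈ A, ∃ t₂ ∈ A, ∀ a ∈ A, F a ⊆ F t₁ ∨ F a ⊆ F t₂ := by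
  -- t₁ of maximum cardinality
  obtain ⟨t₁, ht₁, hmax₁⟩ := Finset.exists_max_image A (fun a => (F a).card) hA
  have max₁ : ∀ x ∈ A, F t₁ ⊆ F x → F x ⊆ F t₁ := fun x hx hsub =>
    (Finset.eq_of_subset_of_card_le hsub (hmax₁ x hx)).symm.subset
  by_cases hB : (A.filter fun a => ¬ F a ⊆ F t₁).Nonempty
  · obtain ⟨t₂, ht₂, hmax₂⟩ := Finset.exists_max_image _ (fun a => (F a).card) hB
    have ht₂A : t₂ ∈ A := (Finset.mem_filter.1 ht₂).1
    have ht₂₁ : ¬ F t₂ ⊆ F t₁ := (Finset.mem_filter.1 ht₂).2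
    refine ⟨t₁, ht₁, t₂, ht₂A, fun a ha => ?_⟩
    by_contra hnot
    rw [not_or] at hnot
    -- a third maximal element among those below neither
    have hC : ((A.filter fun a => ¬ F a ⊆ F t₁).filter fun a => ¬ F a ⊆ F t₂).Nonempty :=
      ⟨a, Finset.mem_filter.2 ⟨Finset.mem_filter.2 ⟨ha, hnot.1⟩, hnot.2⟩⟩
    obtain ⟨t₃, ht₃, hmax₃⟩ := Finset.exists_max_image _ (fun a => (F a).card) hC
    have ht₃B : t₃ ∈ A.filter fun a => ¬ F a ⊆ F t₁ := (Finset.mem_filter.1 ht₃).1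
    have ht₃A : t₃ ∈ A := (Finset.mem_filter.1 ht₃B).1
    have ht₃₁ : ¬ F t₃ ⊆ F t₁ := (Finset.mem_filter.1 ht₃B).2
    have ht₃₂ : ¬ F t₃ ⊆ F t₂ := (Finset.mem_filter.1 ht₃).2
    have ht₁₂ : ¬ F t₁ ⊆ F t₂ := fun h => ht₂₁ (max₁ t₂ ht₂A h)
    have ht₁₃ : ¬ F t₁ ⊆ F t₃ := fun h => ht₃₁ (max₁ t₃ ht₃A h)
    have ht₂₃ : ¬ F t₂ ⊆ F t₃ := fun h =>
      ht₃₂ (Finset.eq_of_subset_of_card_le h (hmax₂ t₃ ht₃B)).symm.subset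
    exact h3 t₁ ht₁ t₂ ht₂A t₃ ht₃A ht₁₂ ht₂₁ ht₁₃ ht₃₁ ht₂₃ ht₃₂
  · refine ⟨t₁, ht₁, t₁, ht₁, fun a ha => Or.inl ?_⟩
    by_contra hna
    exact hB ⟨a, Finset.mem_filter.2 ⟨ha, hna⟩⟩

/-! ### No three-antichain among the up-families -/

/-- Intersections of two `t`–`b` cuts of minimum boundary `m` through a common vertex again have boundary `m`
(submodularity). [folklore] -/
theorem card_bdry_inter_eq {E : Finset (Sym2 V)} {m : ℕ} {t b : V} {P Q : Finset V}
    (hcut : ∀ W : Finset V, t ∈ W → b ∉ W → m ≤ (bdry E W).card)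
    (htP : t ∈ P) (htQ : t ∈ Q) (hbP : b ∉ P) (hbQ : b ∉ Q)
    (hP : (bdry E P).card = m) (hQ : (bdry E Q).card = m) : (bdry E (P ∩ Q)).card = m := by
  have hsub := card_bdry_inter_add_union_le E P Q
  have hu : m ≤ (bdry E (P ∪ Q)).card :=
    hcut _ (Finset.mem_union_left _ htP) (by rw [Finset.mem_union, not_or]; exact ⟨hbP, hbQ⟩)
  have hi : m ≤ (bdry E (P ∩ Q)).card :=
    hcut _ (Finset.mem_inter.2 ⟨htP, htQ⟩) (fun h => hbP (Finset.mem_inter.1 h).1)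
  omega

/-- A witness of non-inclusion `F_t ⊄ F_{t'}`: an `S ∈ F_t` whose `o`-cluster `U` contains `o, t`, avoids `t', b`,
and has exactly `m` boundary pairs. [folklore] -/
theorem exists_witness_of_not_subset {E : Finset (Sym2 V)} {m : ℕ} {o b t t' : V}
    (hmt : ∀ T ∈ E.powerset, (↑T : Set (Sym2 V)) ∈ (openConn t b)ᶜ → m ≤ (E \ T).card)
    (hns : ¬ upFam E m o b t ⊆ upFam E m o b t') :
    ∃ S : Finset (Sym2 V), S ∈ upFam E m o b t ∧ o ∈ clus (↑S : Set (Sym2 V)) o ∧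
      t ∈ clus (↑S : Set (Sym2 V)) o ∧ t' ∉ clus (↑S : Set (Sym2 V)) o ∧ b ∉ clus (↑S : Set (Sym2 V)) o ∧
      (bdry E (clus (↑S : Set (Sym2 V)) o)).card = m := by
  obtain ⟨S, hS, hS'⟩ := Finset.not_subset.1 hns
  obtain ⟨ht, hb, hcard⟩ := clus_facts_of_mem_upFam hS hmt
  exact ⟨S, hS, mem_clus.2 SimpleGraph.Reachable.rfl, ht, fun h => hS' ((mem_upFam_iff_mem_clus hS).2 h), hb,
    hcard⟩

/-- **No three-antichain.** If the disconnection events of the relays `t₁, t₂, t₃` all have order `≥ m`, the three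
up-families `F_{t_i}` are not pairwise `⊆`-incomparable (sub/posimodularity of the support cut function:
`…CornerCuts.card_bdry_inter_add_union_le` and `…CutAntichain.cut_inter₃_eq_zero`). [folklore] -/
theorem upFam_no_three_antichain (E : Finset (Sym2 V)) (m : ℕ) (o b : V) {t₁ t₂ t₃ : V}
    (hm₁ : ∀ T ∈ E.powerset, (↑T : Set (Sym2 V)) ∈ (openConn t₁ b)ᶜ → m ≤ (E \ T).card)
    (hm₂ : ∀ T ∈ E.powerset, (↑T : Set (Sym2 V)) ∈ (openConn t₂ b)ᶜ → m ≤ (E \ T).card)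
    (hm₃ : ∀ T ∈ E.powerset, (↑T : Set (Sym2 V)) ∈ (openConn t₃ b)ᶜ → m ≤ (E \ T).card)
    (h₁₂ : ¬ upFam E m o b t₁ ⊆ upFam E m o b t₂) (h₂₁ : ¬ upFam E m o b t₂ ⊆ upFam E m o b t₁)
    (h₁₃ : ¬ upFam E m o b t₁ ⊆ upFam E m o b t₃) (h₃₁ : ¬ upFam E m o b t₃ ⊆ upFam E m o b t₁)
    (h₂₃ : ¬ upFam E m o b t₂ ⊆ upFam E m o b t₃) (h₃₂ : ¬ upFam E m o b t₃ ⊆ upFam E m o b t₂) : False := by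
  have cut₁ : ∀ W : Finset V, t₁ ∈ W → b ∉ W → m ≤ (bdry E W).card := fun W h h' => le_card_bdry_of_order hm₁ h h'
  have cut₂ : ∀ W : Finset V, t₂ ∈ W → b ∉ W → m ≤ (bdry E W).card := fun W h h' => le_card_bdry_of_order hm₂ h h'
  have cut₃ : ∀ W : Finset V, t₃ ∈ W → b ∉ W → m ≤ (bdry E W).card := fun W h h' => le_card_bdry_of_order hm₃ h h'
  obtain ⟨S₁₂, hS₁₂, ho₁₂, ht₁₂, hn₁₂, hb₁₂, hc₁₂⟩ := exists_witness_of_not_subset hm₁ h₁₂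
  obtain ⟨S₁₃, -, ho₁₃, ht₁₃, hn₁₃, hb₁₃, hc₁₃⟩ := exists_witness_of_not_subset hm₁ h₁₃
  obtain ⟨S₂₁, -, ho₂₁, ht₂₁, hn₂₁, hb₂₁, hc₂₁⟩ := exists_witness_of_not_subset hm₂ h₂₁
  obtain ⟨S₂₃, -, ho₂₃, ht₂₃, hn₂₃, hb₂₃, hc₂₃⟩ := exists_witness_of_not_subset hm₂ h₂₃
  obtain ⟨S₃₁, -, ho₃₁, ht₃₁, hn₃₁, hb₃₁, hc₃₁⟩ := exists_witness_of_not_subset hm₃ h₃₁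
  obtain ⟨S₃₂, -, ho₃₂, ht₃₂, hn₃₂, hb₃₂, hc₃₂⟩ := exists_witness_of_not_subset hm₃ h₃₂
  set U₁₂ := clus (↑S₁₂ : Set (Sym2 V)) o with hU₁₂
  set U₁₃ := clus (↑S₁₃ : Set (Sym2 V)) o
  set U₂₁ := clus (↑S₂₁ : Set (Sym2 V)) o
  set U₂₃ := clus (↑S₂₃ : Set (Sym2 V)) o
  set U₃₁ := clus (↑S₃₁ : Set (Sym2 V)) o
  set U₃₂ := clus (↑S₃₂ : Set (Sym2 V)) o
  -- the three intersections
  have c₁ : (bdry E (U₁₂ ∩ U₁₃)).card = m := card_bdry_inter_eq cut₁ ht₁₂ ht₁₃ hb₁₂ hb₁₃ hc₁₂ hc₁₃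
  have c₂ : (bdry E (U₂₁ ∩ U₂₃)).card = m := card_bdry_inter_eq cut₂ ht₂₁ ht₂₃ hb₂₁ hb₂₃ hc₂₁ hc₂₃
  have c₃ : (bdry E (U₃₁ ∩ U₃₂)).card = m := card_bdry_inter_eq cut₃ ht₃₁ ht₃₂ hb₃₁ hb₃₂ hc₃₁ hc₃₂
  -- memberships: t_i ∈ U_i, t_i ∉ U_j, b ∉ U_i
  have m₁ : t₁ ∈ U₁₂ ∩ U₁₃ := Finset.mem_inter.2 ⟨ht₁₂, ht₁₃⟩
  have m₂ : t₂ ∈ U₂₁ ∩ U₂₃ := Finset.mem_inter.2 ⟨ht₂₁, ht₂₃⟩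
  have m₃ : t₃ ∈ U₃₁ ∩ U₃₂ := Finset.mem_inter.2 ⟨ht₃₁, ht₃₂⟩
  have n₁₂ : t₁ ∉ U₂₁ ∩ U₂₃ := fun h => hn₂₁ (Finset.mem_inter.1 h).1
  have n₁₃ : t₁ ∉ U₃₁ ∩ U₃₂ := fun h => hn₃₁ (Finset.mem_inter.1 h).1
  have n₂₁ : t₂ ∉ U₁₂ ∩ U₁₃ := fun h => hn₁₂ (Finset.mem_inter.1 h).1
  have n₂₃ : t₂ ∉ U₃₁ ∩ U₃₂ := fun h => hn₃₂ (Finset.mem_inter.1 h).2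
  have n₃₁ : t₃ ∉ U₁₂ ∩ U₁₃ := fun h => hn₁₃ (Finset.mem_inter.1 h).2
  have n₃₂ : t₃ ∉ U₂₁ ∩ U₂₃ := fun h => hn₂₃ (Finset.mem_inter.1 h).2
  have nb₁ : b ∉ U₁₂ ∩ U₁₃ := fun h => hb₁₂ (Finset.mem_inter.1 h).1
  have nb₂ : b ∉ U₂₁ ∩ U₂₃ := fun h => hb₂₁ (Finset.mem_inter.1 h).1
  have nb₃ : b ∉ U₃₁ ∩ U₃₂ := fun h => hb₃₁ (Finset.mem_inter.1 h).1
  -- lower bounds for differences (each contains its own t_i and not b)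
  have low : ∀ {t : V} {P Q : Finset V}, (∀ W : Finset V, t ∈ W → b ∉ W → m ≤ (bdry E W).card) →
      t ∈ P → t ∉ Q → b ∉ P →
      (m : ℤ) ≤ ∑ u, ∑ v, if u ∈ P \ Q ∧ v ∈ (P \ Q)ᶜ then (↑(mult E u v) : ℤ) else 0 := by
    intro t P Q hcut htP htQ hbP
    rw [← card_bdry_eq_adj]
    exact_mod_cast hcut _ (Finset.mem_sdiff.2 ⟨htP, htQ⟩) (fun h => hbP (Finset.mem_sdiff.1 h).1)
  have eqm : ∀ {P : Finset V}, (bdry E P).card = m →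
      (∑ u, ∑ v, if u ∈ P ∧ v ∈ Pᶜ then (↑(mult E u v) : ℤ) else 0) = (m : ℤ) := by
    intro P hP; rw [← card_bdry_eq_adj, hP]
  have hz := cut_inter₃_eq_zero (mult E) (mult_comm E) (U₁₂ ∩ U₁₃) (U₂₁ ∩ U₂₃) (U₃₁ ∩ U₃₂) (m : ℤ)
    (eqm c₁) (eqm c₂) (eqm c₃)
    (low cut₁ m₁ n₁₂ nb₁) (low cut₂ m₂ n₂₁ nb₂) (low cut₁ m₁ n₁₃ nb₁) (low cut₃ m₃ n₃₁ nb₃)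
    (low cut₂ m₂ n₂₃ nb₂) (low cut₃ m₃ n₃₂ nb₃)
    (low cut₁ m₁ (by rw [Finset.mem_union, not_or]; exact ⟨n₁₂, n₁₃⟩) nb₁)
    (low cut₂ m₂ (by rw [Finset.mem_union, not_or]; exact ⟨n₂₁, n₂₃⟩) nb₂)
    (low cut₃ m₃ (by rw [Finset.mem_union, not_or]; exact ⟨n₃₁, n₃₂⟩) nb₃)
  -- the triple intersection Z ∋ o has no boundary pair; but o ↔ t₁ in S₁₂ and t₁ ∉ Z
  set Z := U₁₂ ∩ U₁₃ ∩ (U₂₁ ∩ U₂₃) ∩ (U₃₁ ∩ U₃₂) with hZ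
  have hZ0 : (bdry E Z).card = 0 := by
    have h := card_bdry_eq_adj E Z
    rw [hz] at h
    exact_mod_cast h
  have hoZ : o ∈ Z := by
    simp only [hZ, Finset.mem_inter]
    exact ⟨⟨⟨ho₁₂, ho₁₃⟩, ho₂₁, ho₂₃⟩, ho₃₁, ho₃₂⟩
  have ht₁Z : t₁ ∈ Z :=
    reachable_mem_of_card_bdry_eq_zero (mem_upFam.1 hS₁₂).1 hZ0 (mem_clus.1 ht₁₂) hoZ
  have : t₁ ∈ U₂₁ := (Finset.mem_inter.1 (Finset.mem_inter.1 (Finset.mem_inter.1 ht₁Z).1).2).1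
  exact hn₂₁ this

/-! ### Membership bookkeeping for the tripod events -/

/-- At order `0` every up-family is contained in `{E}`. [folklore] -/
theorem eq_of_mem_upFam_zero {E : Finset (Sym2 V)} {o b a : V} {S : Finset (Sym2 V)}
    (hS : S ∈ upFam E 0 o b a) : S = E := by
  obtain ⟨hSE, -, hcard, -⟩ := mem_upFam.1 hS
  exact Finset.Subset.antisymm hSE (Finset.sdiff_eq_empty_iff_subset.1 (Finset.card_eq_zero.1 hcard))

/-- A member of `F_{t₂} \ F_{t₁}` realizes the tripod event `{o ↔ t₂} ∩ {t₁ ↔ b} ∩ {t₂ ↮ t₁}` (uses: both sides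
of a minimum realizer are connected, `m ≥ 1`). [folklore] -/
theorem mem_realizers_tripod_of_mem_sdiff {E : Finset (Sym2 V)} {m : ℕ} (hm1 : 1 ≤ m) {o b t₁ t₂ : V}
    (hm₁ : ∀ T ∈ E.powerset, (↑T : Set (Sym2 V)) ∈ (openConn t₁ b)ᶜ → m ≤ (E \ T).card)
    (hm₂ : ∀ T ∈ E.powerset, (↑T : Set (Sym2 V)) ∈ (openConn t₂ b)ᶜ → m ≤ (E \ T).card)
    {S : Finset (Sym2 V)} (h₂ : S ∈ upFam E m o b t₂) (h₁ : S ∉ upFam E m o b t₁) :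
    S ∈ realizers E (openConn o t₂ ∩ openConn t₁ b ∩ (openConn t₂ t₁)ᶜ) m := by
  obtain ⟨hSE, ht₂b, hcard, ht₂o⟩ := mem_upFam.1 h₂
  have hnot : ¬ (openGraph (↑S : Set (Sym2 V))).Reachable t₂ t₁ := fun h =>
    h₁ ((mem_upFam_iff_mem_clus h₂).2 (mem_clus.2 (ht₂o.symm.trans h)))
  have hbU : b ∉ clus (↑S : Set (Sym2 V)) t₂ := fun h => ht₂b (mem_clus.1 h)
  have ht₁U : t₁ ∉ clus (↑S : Set (Sym2 V)) t₂ := fun h => hnot (mem_clus.1 h)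
  have hself : t₂ ∈ clus (↑S : Set (Sym2 V)) t₂ := mem_clus.2 SimpleGraph.Reachable.rfl
  have hle : (E \ S).card ≤ (bdry E (clus (↑S : Set (Sym2 V)) t₂)).card := by
    rw [hcard]; exact le_card_bdry_of_order hm₂ hself hbU
  have hreal := sdiff_eq_bdry_clus_of_card_le t₂ hle
  have hc : (bdry E (clus (↑S : Set (Sym2 V)) t₂)).card = m := by rw [← hreal, hcard]
  have ht₁b : (openGraph (↑S : Set (Sym2 V))).Reachable t₁ b :=
    reachable_target_of_min_realizer hm1 hreal hc hbU ht₁U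
      (fun W h h' => le_card_bdry_of_order hm₂ h h') (fun W h h' => le_card_bdry_of_order hm₁ h h')
  refine mem_realizers.2 ⟨hSE, ?_, hcard⟩
  simp only [Set.mem_inter_iff, Set.mem_compl_iff, openConn, Set.mem_setOf_eq]
  exact ⟨⟨ht₂o.symm, ht₁b⟩, hnot⟩

/-- An order-`m` realizer of the tripod event `{o ↔ t₂} ∩ {t₂ ↔ b} ∩ {t₂ ↮ t₁}` is a realizer of `{t₁ ↮ b}` outside
`F_{t₁}`. [folklore] -/
theorem realizers_tripod_subset_sdiff (E : Finset (Sym2 V)) (m : ℕ) (o b t₁ t₂ : V) :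
    realizers E (openConn o t₂ ∩ openConn t₂ b ∩ (openConn t₂ t₁)ᶜ) m ⊆
      realizers E (openConn t₁ b)ᶜ m \ upFam E m o b t₁ := by
  intro S hS
  obtain ⟨hSE, hT, hcard⟩ := mem_realizers.1 hS
  simp only [Set.mem_inter_iff, Set.mem_compl_iff, openConn, Set.mem_setOf_eq] at hT
  obtain ⟨⟨hot₂, ht₂b⟩, hnot⟩ := hT
  rw [Finset.mem_sdiff]
  refine ⟨mem_realizers.2 ⟨hSE, ?_, hcard⟩, fun h => ?_⟩
  · simp only [Set.mem_compl_iff, openConn, Set.mem_setOf_eq]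
    exact fun ht₁b => hnot (ht₂b.trans ht₁b.symm)
  · obtain ⟨-, -, -, ht₁o⟩ := mem_upFam.1 h
    exact hnot ((ht₁o.trans hot₂).symm)

omit [Fintype V] in
/-- Orders of the four tripod events are at least the orders of the relays' disconnection events. [folklore] -/
theorem order_tripod_left {E : Finset (Sym2 V)} {m : ℕ} {o b t₁ t₂ : V}
    (hm₂ : ∀ T ∈ E.powerset, (↑T : Set (Sym2 V)) ∈ (openConn t₂ b)ᶜ → m ≤ (E \ T).card) :
    ∀ T ∈ E.powerset, (↑T : Set (Sym2 V)) ∈ openConn o t₂ ∩ openConn t₁ b ∩ (openConn t₂ t₁)ᶜ →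
      m ≤ (E \ T).card := by
  intro T hT h
  simp only [Set.mem_inter_iff, Set.mem_compl_iff, openConn, Set.mem_setOf_eq] at h
  refine hm₂ T hT ?_
  simp only [Set.mem_compl_iff, openConn, Set.mem_setOf_eq]
  exact fun ht₂b => h.2 (ht₂b.trans h.1.2.symm)

omit [Fintype V] in
/-- Orders of the tripod events, right-hand form. [folklore] -/
theorem order_tripod_right {E : Finset (Sym2 V)} {m : ℕ} {o b t₁ t₂ : V}
    (hm₁ : ∀ T ∈ E.powerset, (↑T : Set (Sym2 V)) ∈ (openConn t₁ b)ᶜ → m ≤ (E \ T).card) :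
    ∀ T ∈ E.powerset, (↑T : Set (Sym2 V)) ∈ openConn o t₂ ∩ openConn t₂ b ∩ (openConn t₂ t₁)ᶜ →
      m ≤ (E \ T).card := by
  intro T hT h
  simp only [Set.mem_inter_iff, Set.mem_compl_iff, openConn, Set.mem_setOf_eq] at h
  refine hm₁ T hT ?_
  simp only [Set.mem_compl_iff, openConn, Set.mem_setOf_eq]
  exact fun ht₁b => h.2 (h.1.2.trans ht₁b.symm)


end Corner

end Summit.CriticalPhenomena.PercolationContinuityZ3.Theorems

end
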